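import Mathlib
import HarnessLib
import HarnessLib.Audit
import Summits.CriticalPhenomena.Statement
import HarnessLib.Audit.Status.Attr

/-!
Route: MonotoneBlocking

DORMANT since 2026-08-26T06:32:20Z (reconciler: no traction for 8.4 d (last activity item-evidence-added at 2026-08-17T20:48:00Z); parked, not closed — `ledger route dormant route-CriticalPhenomena-MonotoneBlocking --off` to reactivate) — unstaffed, not closed; items shared with open routes are served there. `ledger route dormant <id> --off` reactivates.

# Route MonotoneBlocking — coarse-graining the critical magnet is monotone — block covariances rise
with block size, so the scaling limit exists as a supremum

It suffices to show X = BM₂ ∧ BM_mom ∧ NS ∧ LAC. BM₂ (MonotoneBlockingTwo, card monotone-blocking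
K1): for the critical n.n. spin-½
state on ℤ³ and S_L(Lk) the spin sum over the cube Lk + [0,L)³, the normalisation-free block
covariance ρ(L;k) = ⟨S_L(0)S_L(Lk)⟩/⟨S_L²⟩ is
NON-DECREASING in L for every offset k and ALL L ≥ 1. BM_mom (MonotoneBlockingMoments, card K2 cut
to what the assembly needs): the
even normalised block moments ⟨∏ S_L(Lkᵢ)⟩/⟨S_L²⟩^m at pairwise non-adjacent block offsets are
non-decreasing in L. A monotone bounded
net converges along the FULL filter: existence of η(3) and of the dilation-covariant pointwise
scaling limit of all n-point functions is
then soft analysis (supports), with the block→point transfer borrowing NS (the caged-point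
equicontinuity crux of MirrorHoelderCompactness,
whose doubling crux (D) BM₂ implies outright) and rotations/inversion/U₄ imported as LAC (same
route's complement).
Lean: `MonotoneBlockingTwo ∧ MonotoneBlockingMoments ∧ NonSeparableModulus ∧ LimitsAreConformal`

## Assembly
Pure logic (kernel-checked in Sketch.lean, theorem `closes`, rc 0, no sorry): BlockingGivesLimit
applied to BM₂, BM_mom and
(BlockingGivesRegularity BM₂ NS) yields ρ, Δ, S with ρ > 0 on (0,1], Δ > 0, the pointwise limit,
normalisation, non-degeneracy,
translation invariance and scale covariance; LimitsAreConformal upgrades to rotation invariance,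
inversion covariance and U₄ ≢ 0;
pack IsMoebiusCovariant Δ S := ⟨⟨translation, rotation⟩, scale, inversion⟩.

Rationale: WHY THIS LINE. Existence of the limit is the clause no open route attacks with a mechanism: ~40 of
the 50 route files posit it (ExistsScaleCovariantLimit,
MoebiusLimit, PointwiseLimit) and attack symmetry or U₄. The card's object is the blocking ORBIT of
one measure read in normalisation-free
block moments; its conjecture is that this orbit is MONOTONE (indeed a positive-definite Schur
cascade: the lattice block field is the
fixed-point block field smeared by independent p.d. noise thinning octave by octave), starting from
the Jensen-extremal bare point
(Rademacher spins minimise every even moment; the hard-spin 'nugget' sits in the denominator) and,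
asymptotically, approaching from below
with the measured sign of the leading irrelevant amplitude of spin-½ (arXiv:1004.4486 §5,
arXiv:1806.03558 §3.5). Monotone + bounded
(ρ ∈ [0,1]; Newman1975Gaussian for higher moments) replaces the contraction that rigorous RG cannot
buy at ε = 1, λ = ∞ — no renormalised
Hamiltonian (PositionSpaceRGNonGibbsian evaded), no small parameter, no semiflow to build (contrast
MonotoneRG: eventual monotonicity of
POINT correlators under a Hirsch–Smith criterion). Imported area: monotone iteration from an
extremal element as an existence engine
(recursive distributional equations, Aldous–Bandyopadhyay) and spectral/Schur positivity; lattice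
inputs AizenmanDuminilCopinAnnals2021
Prop 4.2 (MMS), criticalTwoPoint_bounds_holds. Route-level deltas over the card: BM₂ ⇒ all-scale
doubling (ρ(L;3e₁) ≥ G(3e₁) + MMS
sandwich) discharges MirrorHoelderCompactness's rank-2 crux (D) and feeds its PROVED
SeparableHoelder/CompactnessGlue; the block→point
transfer runs through NS; exact GFF anchor and an N=64 Swendsen–Wang run (84/84 consecutive
differences positive) already in hand (card).

RANKED CRUXES. #2 MonotoneBlockingTwo (crux) — BM₂ — for all L ≥ 1 and all k ∈ ℤ³,
⟨S_L(0)S_L(Lk)⟩·⟨S_{L+1}²⟩ ≤ ⟨S_{L+1}(0)S_{L+1}((L+1)k)⟩·⟨S_L²⟩ at β_c(3) (card monotone-blocking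
K1; all factors finite sums of criticalTwoPoint 3). [difficulty: open-problem] (why it might fail:
at large L monotonicity is decided by correction-to-scaling signs: a wrong-sign universal amplitude
ratio a_ρ(k)/a_U4 makes some ρ(L;k) overshoot ρ*(k) by O(10⁻²)L^-0.83, invisible in the nugget
regime L ≤ 8 tested so far; BM₂ also implies the open all-scale doubling (D).) [arXiv:1004.4486,
arXiv:1806.03558, arXiv:1912.07973, AizenmanDuminilCopinAnnals2021, MessagerMiracleSoleJSP1977]
#3 MonotoneBlockingMoments (crux) — BM_mom — for every m, every k : Fin 2m → ℤ³ with pairwise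
sup-distance ≥ 2 and every L ≥ 1, ⟨∏ᵢ S_L(Lkᵢ)⟩·⟨S_{L+1}²⟩^m ≤ ⟨∏ᵢ S_{L+1}((L+1)kᵢ)⟩·⟨S_L²⟩^m (card
K2 restricted to separated distinct blocks; m = 1 is BM₂ at |k|∞ ≥ 2). [deps: MonotoneBlockingTwo]
[difficulty: open-problem] (why it might fail: for m ≥ 2 the normalised Ursell part −2M(L;k)
(current-merging probability between blocks) must not decrease slower than the Wick part rises; its
correction-to-scaling sign at mixed offsets is unmeasured — a tetrahedral 4-block MC run decides.)
[Newman1975Gaussian, AizenmanCMP1982, arXiv:1004.4486, arXiv:1912.07973]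
#4 NonSeparableModulus (crux) — (shared verbatim with MirrorHoelderCompactness, item
stmt-CriticalPhenomena-6152) asymptotic equicontinuity of the ρ★-rescaled critical correlators under
one-point moves at configurations where the moving point is NOT nine-mirror separable (caged
points); the separable case is PROVED given doubling, which BM₂ supplies. [difficulty: open-problem]
(why it might fail: no lattice mechanism at caged points: iterated mirror doubling fixes a point
caged in all 26 directions; needs a mixing/regularity input (ADC21 §6, Panis' d=3 current mixing
arXiv:2406.15243) or DLR-inherited regularity — as open as continuity of the 3D limit there.)
[AizenmanDuminilCopinAnnals2021, arXiv:1912.07973, arXiv:2406.15243, DuminilCopinICM2022]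
#5 LimitsAreConformal (crux) — (shared verbatim with MirrorHoelderCompactness, item
stmt-CriticalPhenomena-6154; imported complement, lowest rank) every normalised, non-degenerate,
translation-invariant, scale-covariant pointwise scaling limit of criticalCorr 3 is O(3)-invariant,
inversion covariant with the same Δ, and has U₄ ≢ 0 — HyperoctahedralRP minus existence; this route
does not attack it. [difficulty: open-problem] (why it might fail: all three conclusions open on ℤ³:
rotations only postulated (ICM22 §8.1); Euclid+scale does not give inversion model-blindly
(ScaleCovarianceNotMoebius witnessFamily); U₄ ≢ 0 unproved in d=3 and false for RP long-range models
on ℤ³ (LongRangeTrivialityOnZ3).) [DuminilCopinICM2022, PolandRychkovVichi2019,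
AizenmanDuminilCopinAnnals2021, Literature.Barriers.CriticalPhenomena.ScaleCovarianceNotMoebius,
Literature.Barriers.CriticalPhenomena.LongRangeTrivialityOnZ3]
#9 BlockingGivesRegularity (support) — BM₂ → NS → UniformRegularity (text of item
stmt-CriticalPhenomena-4658 verbatim). Proof plan: BM₂ gives ρ(L;3e₁) ≥ ρ(1;3e₁) = G(3e₁) > 0 for
all L; with blockCov(L,3e₁) ≤ L⁶ g(2L+1) (MMS: G(z) ≤ g(‖z‖∞)) and blockCov(L,0) ≥ c L⁶ g(⌈L/2⌉)
(pairs at ℓ¹-distance ≤ L/2, MMS: G(z) ≥ g(‖z‖₁)) this is all-scale axial doubling g(2n) ≥ κ g(n) =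
TwoPointDoubling (item 6150); then separableHoelder_proof and compactnessGlue_proof (PROVED,
Theorems/MirrorHoelderCompactness*) give the conclusion from NS. [difficulty: M]
[MessagerMiracleSoleJSP1977, AizenmanDuminilCopinAnnals2021,
Literature.Probability.LatticeModels.criticalTwoPoint_bounds_holds, FrohlichIsraelLiebSimon1978]
#9 BlockingGivesLimit (support) — BM₂ → BM_mom → UniformRegularity → ExistsScaleCovariantLimit (item
stmt-CriticalPhenomena-1981 verbatim). Proof plan (soft analysis, engine-free): (1) ρ(L;k) ∈ [0,1]
monotone ⇒ convergent ∀k; normalised block moments bounded by Newman's Gaussian inequality and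
monotone ⇒ convergent for every separated offset configuration; (2) renormalise by ρ_b(δ) :=
L³/√⟨S_L²⟩, L = ⌊1/δ⌋ (ratio to ρ★ bounded by doubling+MMS); (3) for x in a compact K ⊆
NonCoincident and θ < sep(K)/10, equicontinuity (b) replaces each point by its θ-block (block size
⌊θ/δ⌋, offsets eventually constant in δ), so F_δ(2m,x) is within ε of a convergent block moment
times the convergent normalisation ratio ⟨S_{L}²⟩/⟨S_{L'}²⟩ = Σ_{κ,κ'} ρ(L';κ−κ') — Cauchy in δ ⇒
pointwise limit along the full filter, locally uniform by (b); odd n vanish/are controlled via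
m*(β_c)=0 (PROVED) as in UniformRegularity (a); (4) translation invariance from plusCorr_shift,
scale covariance from the block-sum identity for integer ratios + monotone multiplicativity (as in
limitConstruction_proof step (v)), Δ ≥ 1/2 > 0 from scalingDimension_mem_Icc_holds, S := 0 off
NonCoincident, non-degeneracy from (c). [difficulty: L] [Newman1975Gaussian,
MessagerMiracleSoleJSP1977, Literature.Probability.LatticeModels.plusCorr_shift,
Literature.Probability.LatticeModels.scalingDimension_mem_Icc_holds,
Literature.Barriers.CriticalPhenomena.hasPointwiseScalingLimit_of_seq_subseq]

TWO-LAYER PLAN. BM₂ ⇐ SupercriticalBlocking (BM₂(β) for every β > β_c(3): ρ(L;k;β) ↑ 1,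
low-temperature expansion for β ≥ β₁ + near-critical coarse
graining in the window) → ThresholdTransfer (right-continuity of the + state two-point function at
β_c) → BM₂ (k = 2; typed as the stubs of
bc/MonotoneBlockingTwo_birth.lean). BM_mom ⇐ WickPartMonotone (from BM₂) → UrsellPartMonotone
(merging probability M(L;k) non-increasing) →
BM_mom. NS ⇐ (children filed by MirrorHoelderCompactness's tenure, shared).

KILL CRITERIA. A certified violation ρ(L+1;k) < ρ(L;k) at β_c (MC with controlled torus bias,
L(|k|+1) ≤ N/8, or an exact small-L inequality among
critical two-point values contradicting criticalTwoPoint bounds) refutes MonotoneBlockingTwo: close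
`refuted:MonotoneBlockingTwo` unless the
violation is confined to L < L₀ (then repair to the eventual version, which still closes existence
but concedes the novelty delta). A decreasing
separated 4-block moment refutes MonotoneBlockingMoments only — pivot to BM₂ +
PointwiseLimit-for-n≥4 from another uniqueness input. NS refuted
(a caged-configuration discontinuity) breaks MirrorHoelderCompactness too — pivot to a θ-smeared
(block-field) version of the Statement's existence
clause. ExistsScaleCovariantLimit proved elsewhere moots the two new cruxes' role (they remain of
stand-alone interest: η(3) exists, β_c = inf{β : blocking monotone}).

NOT DECOMPOSED YET. The supercritical window β ↓ β_c of the threshold strategy (constants of the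
coarse graining), the spectral-smearing (p.d.) refinement SS of the
card, the dyadic identity + nugget-tolerance lemma, the odd-n bookkeeping and the exact form of the
block→point Cauchy estimate — layer-2 children
or prover-attached lemmas (`--supports`), not items.

CHEAPEST FALSIFIER. One cluster-MC run (Swendsen–Wang/Wolff, β_c = 0.221654626, periodic N = 128,
full two-point function by FFT): the twelve offsets |k|∞ ≤ 3 for
L = 1…12 with L(|k|+1) ≤ 16 — any significantly negative consecutive difference kills BM₂; plus the
tetrahedral 4-block moment R(L; 0, 2e₁, 2e₂, 2e₃),
L = 1…8, for BM_mom. Already run (card, job j004368, N = 64): all 84 consecutive differences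
positive, e₁: 0.3314 → 0.5363; exact GFF rung
(j004144/j004367): BM₂ for all |k|∞ ≤ 8, L ≤ 8, SS minors p.d.; subcritical and 1D controls fail as
they must. Not re-run this cycle (planner seat, no new kit job).

NUMBERS. 2Δ_σ = 1 + η = 1.0362978(...) (bootstrap, KosPolandSimmonsDuffinVichi2016); ω = 0.832(6),
Ū₄* = 1.60357(1), a(Ising) = −0.2983(6) (arXiv:1004.4486 §5);
U* = 0.46548(5) (arXiv:1806.03558); margin of BM₂ at L = 1→2 for far k: needs G(2k)/G(k) ≥
64/⟨S_2²⟩·… ≈ 0.37 vs 2^{-2Δ} = 0.488 (30 % nugget margin);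
card MC e₁-offset values ρ(L;e₁) = 0.3314, 0.4326, 0.4730, 0.4940, 0.5078, 0.5185, 0.5277, 0.5363 (L
= 1…8). Items at open: 7 (4 cruxes, 2 supports, 1 assembly).

DEFINITION REQUESTS. None: blockCov/blockMoment are `let`-bound finite sums over criticalTwoPoint 3
/ criticalCorr 3 (Literature.Probability.LatticeModels); Sketch.lean
records them as honest defs with `Iff.rfl` bridges (monotoneBlockingTwo_iff,
monotoneBlockingMoments_iff).

Novelty: Searches (2026-08-17): `lit frontier CriticalPhenomena --since 2022` (60 rows; 3D items:
arXiv:2604.05772 percolation-in-3D-Ising numerics, arXiv:2601.04840 3D Brownian loop-soup clusters,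
Panis triviality — none on existence/monotone blocking); `lit search --hybrid "block spin covariance
monotone increasing block size critical Ising renormalization inequality"` (12 textbook hits; Binder
1987 pp.197–216 read: MCRG matches blocked correlations, no monotonicity); `lit galaxy search "block
spin correlation functions increase monotonically with the block size" --star all` (0); `lit galaxy
search --star pdf --mode bm25 "Monte Carlo renormalization group three-dimensional Ising block spin
correlation"` (15, none relevant); `lit search --source s2 "block spin Ising monotonicity"` (14,
mean-field 'block spin Ising models', irrelevant); `lit search --source openalex` (budget exhausted,
logged); read arXiv:2406.15243 pp.1–12 (Panis IIC/mixing d=3); the 50 open route files' levers; all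
115 cards' titles/grades; MonotoneRG.lean and MirrorHoelderCompactness.lean items in full.
Nearest prior art found: arXiv:1004.4486 §5 / arXiv:1806.03558 §3 (definite-sign approach of U₄(L) —
FSS folklore, one observable, asymptotic, no inequality, no existence use); arXiv:1912.07973 Prop
4.2 / Thm 5.12 (MMS; regular scales in abundance); in tree: route MonotoneRG (eventual monotonicity
of point correlators, Hirsch–Smith SOP criterion) and MirrorHoelderCompactness (doubling + Hölder
compactness; Pointwise  [refs: 2604.05772, 2601.04840, 2406.15243, 1004.4486, 1806.03558, 1912.07973]

Barriers (technique_class: monotone-blocking, spectral-smearing, block-spin): - technique_class: monotone-blocking, spectral-smearing, block-spin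
- Literature.Barriers.CriticalPhenomena.PositionSpaceRGNonGibbsian: evaded — no map on
Hamiltonians/interactions is formed; BM reads block moments of ONE measure (always defined, evasion
(c) of the audit) and gets convergence from orbit monotonicity, not from a linearised map.
- Literature.Barriers.CriticalPhenomena.RigorousRGSmallParameter: evaded in logic (monotone +
bounded replaces contraction at ε = 1, λ = ∞; extremality of the Rademacher bare point is USED);
conceded: a proof of BM₂ needs near-critical control from β > β_c (threshold strategy).
- Literature.Barriers.CriticalPhenomena.IsingTrivialityFromDimensionFour: respected — BM is
interaction- and dimension-specific (false for improved Blume–Capel D > D*, long-range members; in d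
≥ 4 it would hold towards the Gaussian point); clause (iii) is imported (LAC), not derived.
- Literature.Barriers.CriticalPhenomena.LongRangeTrivialityOnZ3: same — nothing interaction-uniform;
U₄ ≢ 0 imported.
- Literature.Barriers.CriticalPhenomena.ScaleCovarianceNotMoebius: not engaged — dilation covariance
is OBTAINED from full-filter convergence; rotations and inversion are imported by name (LAC =
HRP2Rigidity/LimitRotationInvariant/InversionUpgradeNormalised), never upgraded model-blindly.
- Literature.Barriers.CriticalPhenomena.BootstrapLatticeBlindness: evaded — every statement is about
criticalCorr 3 of the n.n. model; no CFT data enter.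
- Literature.Barriers.Critic

History (route lifecycle, newest last):
- 2026-08-26T06:32:20Z · DORMANT — reconciler: no traction for 8.4 d (last activity item-evidence-added at 2026-08-17T20:48:00Z); parked, not closed — `ledger route dormant route-CriticalPhenomen (operator:999:255635)

sub-problem: Ising3DConformalLimit · status: dormant · opened planner-plan-novel-CriticalPhenomena-Ising3DCon-3ad144fc-v2-g13-0 2026-08-17T01:06:37Z · rev 1 · ledger route-CriticalPhenomena-MonotoneBlocking
GENERATED by the gate from the ledger (D-0016/17). Provers cite these decls: `theorem foo : Summit.CriticalPhenomena.Ising3DConformalLimit.Theses.MonotoneBlocking.<Decl> := …` in Summits/CriticalPhenomena/Ising3DConformalLimit/Theorems/<Name>.lean.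
-/

namespace Summit.CriticalPhenomena.Ising3DConformalLimit.Theses.MonotoneBlocking

open scoped BigOperators Topology Manifold Classical MeasureTheory ProbabilityTheory Matrix InnerProductSpace ComplexConjugate ContinuousMap
open Filter Set Function TopologicalSpace MeasureTheory

attribute [summit_statement] _root_.Ising3DConformalLimit

/-- item stmt-CriticalPhenomena-17054 · crux · rank 2 · open · by planner
why it might fail: at large L monotonicity is decided by correction-to-scaling signs: a wrong-sign universal amplitude ratio a_ρ(k)/a_U4 makes some ρ(L;k) overshoot ρ*(k) by O(10⁻²)L^-0.83, invisible in the nugget regime L ≤ 8 tested so far; BM₂ also implies the open all-scale doubling (D).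
sources: arXiv:1004.4486, arXiv:1806.03558, arXiv:1912.07973, AizenmanDuminilCopinAnnals2021, MessagerMiracleSoleJSP1977
[crux] BM₂ — for all L ≥ 1 and all k ∈ ℤ³, ⟨S_L(0)S_L(Lk)⟩·⟨S_{L+1}²⟩ ≤
⟨S_{L+1}(0)S_{L+1}((L+1)k)⟩·⟨S_L²⟩ at β_c(3) (card monotone-blocking K1; all factors finite sums of
criticalTwoPoint 3). [difficulty: open-problem] -/
@[route_item "route-CriticalPhenomena-MonotoneBlocking", crux]
def MonotoneBlockingTwo : Prop :=
  (let cube : ℕ → Finset (Literature.Probability.LatticeModels.Site 3) := fun L : ℕ => Fintype.piFinset fun _ : Fin 3 => Finset.Ico (0:ℤ) (L:ℤ); let bc : ℕ → Literature.Probability.LatticeModels.Site 3 → ℝ := fun L k => ∑ x ∈ cube L, ∑ y ∈ cube L, Literature.Probability.LatticeModels.criticalTwoPoint 3 ((L:ℤ) • k + x - y); ∀ L : ℕ, 1 ≤ L → ∀ k : Literature.Probability.LatticeModels.Site 3, bc L k * bc (L+1) 0 ≤ bc (L+1) k * bc L 0)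

/-- item stmt-CriticalPhenomena-17055 · crux · rank 3 · open · by planner
why it might fail: for m ≥ 2 the normalised Ursell part −2M(L;k) (current-merging probability between blocks) must not decrease slower than the Wick part rises; its correction-to-scaling sign at mixed offsets is unmeasured — a tetrahedral 4-block MC run decides.
sources: Newman1975Gaussian, AizenmanCMP1982, arXiv:1004.4486, arXiv:1912.07973
[crux] BM_mom — for every m, every k : Fin 2m → ℤ³ with pairwise sup-distance ≥ 2 and every L ≥ 1,
⟨∏ᵢ S_L(Lkᵢ)⟩·⟨S_{L+1}²⟩^m ≤ ⟨∏ᵢ S_{L+1}((L+1)kᵢ)⟩·⟨S_L²⟩^m (card K2 restricted to separated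
distinct blocks; m = 1 is BM₂ at |k|∞ ≥ 2). [deps: MonotoneBlockingTwo] [difficulty: open-problem] -/
@[route_item "route-CriticalPhenomena-MonotoneBlocking", crux]
def MonotoneBlockingMoments : Prop :=
  (let cube : ℕ → Finset (Literature.Probability.LatticeModels.Site 3) := fun L : ℕ => Fintype.piFinset fun _ : Fin 3 => Finset.Ico (0:ℤ) (L:ℤ); let bc0 : ℕ → ℝ := fun L => ∑ x ∈ cube L, ∑ y ∈ cube L, Literature.Probability.LatticeModels.criticalTwoPoint 3 (x - y); let bm : (m : ℕ) → ℕ → (Fin (2*m) → Literature.Probability.LatticeModels.Site 3) → ℝ := fun m L k => ∑ x ∈ Fintype.piFinset (fun _ : Fin (2*m) => cube L), Literature.Probability.LatticeModels.criticalCorr 3 (2*m) (fun i => (L:ℤ) • k i + x i); ∀ (m : ℕ) (k : Fin (2*m) → Literature.Probability.LatticeModels.Site 3), (∀ i j, i ≠ j → ∃ c : Fin 3, (2:ℤ) ≤ |k i c - k j c|) → ∀ L : ℕ, 1 ≤ L → bm m L k * bc0 (L+1) ^ m ≤ bm m (L+1) k * bc0 L ^ m)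

/-- item stmt-CriticalPhenomena-6152 · crux · rank 4 · open · by planner
why it might fail: no lattice mechanism at caged points: iterated mirror doubling fixes a point caged in all 26 directions; needs a mixing/regularity input (ADC21 §6, Panis' d=3 current mixing arXiv:2406.15243) or DLR-inherited regularity — as open as continuity of the 3D limit there.
sources: AizenmanDuminilCopinAnnals2021, arXiv:1912.07973, arXiv:2406.15243, DuminilCopinICM2022
[crux] (NS) = card item M4, the honestly open complement of (SH): asymptotic equicontinuity under
one-point moves at configurations where the moving point is NOT nine-separable. Form: for every n,
compact K ⊆ NonCoincident and ε > 0 there are m, η, δ₀ > 0 such that for δ < δ₀, x ∈ K, ‖y − x_i‖ <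
η and (x, i) not m-separable by any of the nine normals, |F_n^δ(x with x_i ↦ y) − F_n^δ(x)| < ε (the
∃m lets the prover shrink the non-separable zone; SH covers the rest for that m). Partial mechanism
for provers: iterating MirrorCauchySchwarz ('doubling the configuration across a mirror') halves the
Hölder exponent per step and turns a collinear configuration into a planar trapezoid whose inner
vertex one of the 18 rays exposes; by translation invariance it also suffices that all OTHER points
be separable. This resolves collinear and many planar configurations but NOT a point caged by
neighbours in all 26 directions of {−1,0,1}³ (the cage is invariant under every doubling): there a
different input (random-current regularity à la ADC21 §6, or DLR-inherited regularity) is required.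
[deps: SeparableHoelder] [difficulty: open-problem] -/
@[route_item "route-CriticalPhenomena-MonotoneBlocking", crux]
def NonSeparableModulus : Prop :=
  ∀ (n : ℕ) (K : Set (Fin n → EuclideanSpace ℝ (Fin 3))), K ⊆ Literature.Probability.LatticeModels.NonCoincident 3 n → IsCompact K → ∀ ε : ℝ, 0 < ε → ∃ m η δ₀ : ℝ, 0 < m ∧ 0 < η ∧ 0 < δ₀ ∧ ∀ δ ∈ Set.Ioo 0 δ₀, ∀ x ∈ K, ∀ (i : Fin n) (y : EuclideanSpace ℝ (Fin 3)), ‖y - x i‖ < η → ¬ (∃ u : EuclideanSpace ℝ (Fin 3), (∃ i j : Fin 3, i ≠ j ∧ (u = EuclideanSpace.single i 1 ∨ u = EuclideanSpace.single i 1 + EuclideanSpace.single j 1 ∨ u = EuclideanSpace.single i 1 - EuclideanSpace.single j 1)) ∧ ((∀ j : Fin n, j ≠ i → inner ℝ u (x j) + m ≤ inner ℝ u (x i)) ∨ (∀ j : Fin n, j ≠ i → inner ℝ u (x i) + m ≤ inner ℝ u (x j)))) → |Literature.Probability.LatticeModels.rescaledCorrelator (Literature.Probability.LatticeModels.criticalCorr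 3) (fun δ : ℝ => (Literature.Probability.LatticeModels.criticalTwoPoint 3 (Pi.single 0 ⌊δ⁻¹⌋)) ^ (-(1/2:ℝ))) n δ (Function.update x i y) - Literature.Probability.LatticeModels.rescaledCorrelator (Literature.Probability.LatticeModels.criticalCorr 3) (fun δ : ℝ => (Literature.Probability.LatticeModels.criticalTwoPoint 3 (Pi.single 0 ⌊δ⁻¹⌋)) ^ (-(1/2:ℝ))) n δ x| < ε

/-- item stmt-CriticalPhenomena-6154 · crux · rank 5 · open · by planner
why it might fail: all three conclusions open on ℤ³: rotations only postulated (ICM22 §8.1); Euclid+scale does not give inversion model-blindly (ScaleCovarianceNotMoebius witnessFamily); U₄ ≢ 0 unproved in d=3 and false for RP long-range models on ℤ³ (LongRangeTrivialityOnZ3).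
sources: DuminilCopinICM2022, PolandRychkovVichi2019, AizenmanDuminilCopinAnnals2021, Literature.Barriers.CriticalPhenomena.ScaleCovarianceNotMoebius, Literature.Barriers.CriticalPhenomena.LongRangeTrivialityOnZ3
[crux] (LAC) IMPORTED COMPLEMENT (lowest rank): every pointwise scaling limit S of criticalCorr 3 (ρ
> 0 on (0,1]) that is normalised (S = 0 off NonCoincident — the typing fix of
Theorems/IsingEuclidUpgradeRefutations.lean), non-degenerate, translation invariant and scale
covariant with Δ is O(3)-invariant, inversion covariant with the same Δ, and has U₄ ≢ 0. This is
route HyperoctahedralRP minus its existence crux (it follows in three lines from that route's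
HRP2Rigidity + LimitRotationInvariant + InversionUpgradeNormalised +
IsingEuclidUpgradeR4NonGaussian, items 1979/1980/1982/0636), and equally from any other
isotropy/inversion/non-Gaussianity line; this route does not attack it. [difficulty: open-problem] -/
@[route_item "route-CriticalPhenomena-MonotoneBlocking", crux]
def LimitsAreConformal : Prop :=
  ∀ (ρ : ℝ → ℝ) (Δ : ℝ) (S : Literature.Probability.LatticeModels.CorrFamily 3), (∀ δ ∈ Set.Ioc (0:ℝ) 1, 0 < ρ δ) → Literature.Probability.LatticeModels.HasPointwiseScalingLimit (Literature.Probability.LatticeModels.criticalCorr 3) ρ S → (∀ n z, z ∉ Literature.Probability.LatticeModels.NonCoincident 3 n → S n z = 0) → Literature.Probability.LatticeModels.IsNondegenerateTwoPoint S → Literature.Probability.LatticeModels.IsTranslationInvariant S → Literature.Probability.LatticeModels.IsScaleCovariant Δ S → Literature.Probability.LatticeModels.IsRotationInvariant S ∧ Literature.Probability.LatticeModels.IsInversionCovariant Δ S ∧ Literature.Probability.LatticeModels.HasNontrivialU4 S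

/-- item stmt-CriticalPhenomena-17056 · support · rank 9 · closed · proved by Summit.CriticalPhenomena.Ising3DConformalLimit.MonotoneBlockingBlockingGivesRegularity.blockingGivesRegularity_proof @ cc0d5a2cb0d2 (prover) · by planner
sources: MessagerMiracleSoleJSP1977, AizenmanDuminilCopinAnnals2021, Literature.Probability.LatticeModels.criticalTwoPoint_bounds_holds, FrohlichIsraelLiebSimon1978
[support] BM₂ → NS → UniformRegularity (text of item stmt-CriticalPhenomena-4658 verbatim). Proof
plan: BM₂ gives ρ(L;3e₁) ≥ ρ(1;3e₁) = G(3e₁) > 0 for all L; with blockCov(L,3e₁) ≤ L⁶ g(2L+1) (MMS: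
G(z) ≤ g(‖z‖∞)) and blockCov(L,0) ≥ c L⁶ g(⌈L/2⌉) (pairs at ℓ¹-distance ≤ L/2, MMS: G(z) ≥ g(‖z‖₁))
this is all-scale axial doubling g(2n) ≥ κ g(n) = TwoPointDoubling (item 6150); then
separableHoelder_proof and compactnessGlue_proof (PROVED, Theorems/MirrorHoelderCompactness*) give
the conclusion from NS. [difficulty: M] -/
@[route_item "route-CriticalPhenomena-MonotoneBlocking", crux]
def BlockingGivesRegularity : Prop :=
  MonotoneBlockingTwo → NonSeparableModulus → ((∀ (n : ℕ) (K : Set (Fin n → EuclideanSpace ℝ (Fin 3))), K ⊆ Literature.Probability.LatticeModels.NonCoincident 3 n → IsCompact K → (∃ M δ₀ : ℝ, 0 < δ₀ ∧ ∀ δ ∈ Set.Ioo 0 δ₀, ∀ x ∈ K, |Literature.Probability.LatticeModels.rescaledCorrelator (Literature.Probability.LatticeModels.criticalCorr 3) (fun δ : ℝ => (Literature.Probability.LatticeModels.criticalTwoPoint 3 (Pi.single 0 ⌊δ⁻¹⌋)) ^ (-(1/2:ℝ))) n δ x| ≤ M) ∧ (∀ ε : ℝ, 0 < ε → ∃ r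 δ₀ : ℝ, 0 < r ∧ 0 < δ₀ ∧ ∀ δ ∈ Set.Ioo 0 δ₀, ∀ x ∈ K, ∀ y ∈ K, dist x y < r → |Literature.Probability.LatticeModels.rescaledCorrelator (Literature.Probability.LatticeModels.criticalCorr 3) (fun δ : ℝ => (Literature.Probability.LatticeModels.criticalTwoPoint 3 (Pi.single 0 ⌊δ⁻¹⌋)) ^ (-(1/2:ℝ))) n δ x - Literature.Probability.LatticeModels.rescaledCorrelator (Literature.Probability.LatticeModels.criticalCorr 3) (fun δ : ℝ => (Literature.Probability.LatticeModels.criticalTwoPoint 3 (Pi.single 0 ⌊δ⁻¹⌋)) ^ (-(1/2:ℝ))) n δ y| < ε)) ∧ (∀ K : Set (Fin 2 → EuclideanSpace ℝ (Fin 3)), K ⊆ Literature.Probability.LatticeModels.NonCoincident 3 2 → IsCompact K → ∃ m δ₀ : ℝ, 0 < m ∧ 0 < δ₀ ∧ ∀ δ ∈ Set.Ioo 0 δ₀, ∀ x ∈ K, m ≤ Literature.Probability.LatticeModels.rescaledCorrelator (Literature.Probability.LatticeModels.criticalCorr 3) (fun δ : ℝ => (Literature.Probability.LatticeModels.criticalTwoPoint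 3 (Pi.single 0 ⌊δ⁻¹⌋)) ^ (-(1/2:ℝ))) 2 δ x))

-- `BlockingGivesRegularity` holds: proved by `Summit.CriticalPhenomena.Ising3DConformalLimit.MonotoneBlockingBlockingGivesRegularity.blockingGivesRegularity_proof` @ cc0d5a2cb0d2 (its module imports this route file, so no `_holds` link can be stated here).

/-- item stmt-CriticalPhenomena-17057 · support · rank 9 · closed · proved by Summit.CriticalPhenomena.Ising3DConformalLimit.MonotoneBlockingLimit.blockingGivesLimit_proof @ 2311afa2f3b7 (prover) · by planner
sources: Newman1975Gaussian, MessagerMiracleSoleJSP1977, Literature.Probability.LatticeModels.plusCorr_shift, Literature.Probability.LatticeModels.scalingDimension_mem_Icc_holds, Literature.Barriers.CriticalPhenomena.hasPointwiseScalingLimit_of_seq_subseq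
[support] BM₂ → BM_mom → UniformRegularity → ExistsScaleCovariantLimit (item
stmt-CriticalPhenomena-1981 verbatim). Proof plan (soft analysis, engine-free): (1) ρ(L;k) ∈ [0,1]
monotone ⇒ convergent ∀k; normalised block moments bounded by Newman's Gaussian inequality and
monotone ⇒ convergent for every separated offset configuration; (2) renormalise by ρ_b(δ) :=
L³/√⟨S_L²⟩, L = ⌊1/δ⌋ (ratio to ρ★ bounded by doubling+MMS); (3) for x in a compact K ⊆
NonCoincident and θ < sep(K)/10, equicontinuity (b) replaces each point by its θ-block (block size
⌊θ/δ⌋, offsets eventually constant in δ), so F_δ(2m,x) is within ε of a convergent block moment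
times the convergent normalisation ratio ⟨S_{L}²⟩/⟨S_{L'}²⟩ = Σ_{κ,κ'} ρ(L';κ−κ') — Cauchy in δ ⇒
pointwise limit along the full filter, locally uniform by (b); odd n vanish/are controlled via
m*(β_c)=0 (PROVED) as in UniformRegularity (a); (4) translation invariance from plusCorr_shift,
scale covariance from the block-sum identity for integer ratios + monotone multiplicativity (as in
limitConstruction_proof step (v)), Δ ≥ 1/2 > 0 from scalingDimension_mem_Icc_holds, S := 0 off
NonCoincident, non-degeneracy from (c). [difficulty: L] -/
@[route_item "route-CriticalPhenomena-MonotoneBlocking", crux]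
def BlockingGivesLimit : Prop :=
  MonotoneBlockingTwo → MonotoneBlockingMoments → ((∀ (n : ℕ) (K : Set (Fin n → EuclideanSpace ℝ (Fin 3))), K ⊆ Literature.Probability.LatticeModels.NonCoincident 3 n → IsCompact K → (∃ M δ₀ : ℝ, 0 < δ₀ ∧ ∀ δ ∈ Set.Ioo 0 δ₀, ∀ x ∈ K, |Literature.Probability.LatticeModels.rescaledCorrelator (Literature.Probability.LatticeModels.criticalCorr 3) (fun δ : ℝ => (Literature.Probability.LatticeModels.criticalTwoPoint 3 (Pi.single 0 ⌊δ⁻¹⌋)) ^ (-(1/2:ℝ))) n δ x| ≤ M) ∧ (∀ ε : ℝ, 0 < ε → ∃ r δ₀ : ℝ, 0 < r ∧ 0 < δ₀ ∧ ∀ δ ∈ Set.Ioo 0 δ₀, ∀ x ∈ K, ∀ y ∈ K, dist x y < r → |Literature.Probability.LatticeModels.rescaledCorrelator (Literature.Probability.LatticeModels.criticalCorr 3) (fun δ : ℝ => (Literature.Probability.LatticeModels.criticalTwoPoint 3 (Pi.single 0 ⌊δ⁻¹⌋)) ^ (-(1/2:ℝ))) n δ x - Literature.Probability.LatticeModels.rescaledCorrelator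 (Literature.Probability.LatticeModels.criticalCorr 3) (fun δ : ℝ => (Literature.Probability.LatticeModels.criticalTwoPoint 3 (Pi.single 0 ⌊δ⁻¹⌋)) ^ (-(1/2:ℝ))) n δ y| < ε)) ∧ (∀ K : Set (Fin 2 → EuclideanSpace ℝ (Fin 3)), K ⊆ Literature.Probability.LatticeModels.NonCoincident 3 2 → IsCompact K → ∃ m δ₀ : ℝ, 0 < m ∧ 0 < δ₀ ∧ ∀ δ ∈ Set.Ioo 0 δ₀, ∀ x ∈ K, m ≤ Literature.Probability.LatticeModels.rescaledCorrelator (Literature.Probability.LatticeModels.criticalCorr 3) (fun δ : ℝ => (Literature.Probability.LatticeModels.criticalTwoPoint 3 (Pi.single 0 ⌊δ⁻¹⌋)) ^ (-(1/2:ℝ))) 2 δ x)) → (∃ (ρ : ℝ → ℝ) (Δ : ℝ) (S : Literature.Probability.LatticeModels.CorrFamily 3), (∀ δ ∈ Set.Ioc (0:ℝ) 1, 0 < ρ δ) ∧ 0 < Δ ∧ Literature.Probability.LatticeModels.HasPointwiseScalingLimit (Literature.Probability.LatticeModels.criticalCorr 3) ρ S ∧ (∀ n z, z ∉ Literature.Probability.LatticeModels.NonCoincident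 3 n → S n z = 0) ∧ Literature.Probability.LatticeModels.IsNondegenerateTwoPoint S ∧ Literature.Probability.LatticeModels.IsTranslationInvariant S ∧ Literature.Probability.LatticeModels.IsScaleCovariant Δ S)

-- `BlockingGivesLimit` holds: proved by `Summit.CriticalPhenomena.Ising3DConformalLimit.MonotoneBlockingLimit.blockingGivesLimit_proof` @ 2311afa2f3b7 (its module imports this route file, so no `_holds` link can be stated here).

/-- item stmt-CriticalPhenomena-17058 · assembly · rank 1 · open · by planner
sources: DuminilCopinICM2022, ChelkakHonglerIzyurov2015
[assembly] MonotoneBlockingTwo → MonotoneBlockingMoments → NonSeparableModulus → LimitsAreConformal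
→ BlockingGivesRegularity → BlockingGivesLimit → Ising3DConformalLimit. -/
@[route_item "route-CriticalPhenomena-MonotoneBlocking"]
def Assembly : Prop :=
  MonotoneBlockingTwo → MonotoneBlockingMoments → NonSeparableModulus → LimitsAreConformal → BlockingGivesRegularity → BlockingGivesLimit → Ising3DConformalLimit

/-! D-0027 §2.1 — DECIDING THEOREM (planner-authored via `route open/edit --closes-file`; by planner-plan-novel-CriticalPhenomena-Ising3DCon-3ad144fc-v2- 2026-08-17T01:06:37Z):
its hypotheses are this route's items and its conclusion the sub-problem Statement (glue_lint), and it elaborates with this file. -/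

@[closes "route-CriticalPhenomena-MonotoneBlocking"] theorem closes (hBM2 : MonotoneBlockingTwo) (hBMM : MonotoneBlockingMoments)
    (hNS : NonSeparableModulus) (hLAC : LimitsAreConformal)
    (hReg : BlockingGivesRegularity) (hLim : BlockingGivesLimit) : _root_.Ising3DConformalLimit := by
  obtain ⟨ρ, Δ, S, hρ, hΔ, hlim, hnorm, hnd, htr, hsc⟩ := hLim hBM2 hBMM (hReg hBM2 hNS)
  obtain ⟨hrot, hinv, hU4⟩ := hLAC ρ Δ S hρ hlim hnorm hnd htr hsc
  exact ⟨ρ, Δ, S, hρ, hΔ, hlim, hnd, ⟨⟨htr, hrot⟩, hsc, hinv⟩, hU4⟩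

end Summit.CriticalPhenomena.Ising3DConformalLimit.Theses.MonotoneBlocking
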